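import Summits.AtomisticToContinuum.Crystallization.Theorems.ChargedEnergyGapRoofRelabel
import Summits.AtomisticToContinuum.Crystallization.Theorems.ChargedEnergyGapStencilChart
import HarnessLib
import Summits.AtomisticToContinuum.Crystallization.Theorems.ChargedEnergyGapFibreChargeC

/-!
# ChargedEnergyGap · NODE 111 «AxisWLOG» (door D3) — the 48 relabellings act on depth tuples; (T¹ᶜ) may be checked on a fundamental domain

decomp-a2c lens-3 g92 (critic r1662 (D)(G): the station of record is a station ∩ the fundamental domain of the 48 relabellings, WITH this
node typed and proved; imports tree NODE 106 «RoofRelabel» (`relabel`, `roofVal_relabel`, `feetHoleCost_eq_roofVal`, `vtxW`) and tree NODE 92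
«StencilChart» (`IsChartRealisable`, `realisRow_iff_coord`, `StencilChartLawQ`)).

THE ACTION.  A relabelling `relabel g σ : Fin 3 × Bool → Fin 3 × Bool` (axis permutation `axp g`, pole-flip pattern `sgn σ`; tree NODE 97) is
induced by the SIGNED AXIS PERMUTATION `latMap g σ` of the lattice `ℤ³` (`e_a ↦ ± e_{axp g a}`, an isometry fixing the hole `0` and permuting
its seven-point stencil: `latMap_zero`, `latMap_holeVertex`).  The RELABELLED TUPLE is the pull-back `tupleRelabel g σ dt := dt ∘ latMap g σ`;
on the stencil it reads `dt 0` at the centre and `dt (holeVertex 0 (relabel g σ q))` at vertex `q` (`tupleRelabel_vertex`).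

THE FOUR INVARIANCES (all PROVED, every `g σ`):
* positivity on the stencil (`pos_tupleRelabel`);
* chart realisability (`isChartRealisable_tupleRelabel`): the unit direction `u` of the image point is twisted back by the same signed
  permutation (`twistVec`; unit by `norm_twistVec`; rows by `realisRow_iff_coord` and the reindexing `sum_axpInv` of NODE 97);
* tuple admissibility (`isTupleHole_tupleRelabel`, an `↔`): the min vertex depth is a symmetric function of the six vertex depths
  (`hDepthMin_tupleRelabel`) and the max-kink a symmetric function of the three pole-pair sums (`hKink_tupleRelabel`, `hMaxKink_tupleRelabel`);
* the two sides of the law: `feetHoleCost` (`feetHoleCost_tupleRelabel`, by `roofVal_relabel`) and the cap argument `chargeDepth`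
  (`chargeDepth_tupleRelabel`, for `ρ ≠ 0`, through the attribution-free formula `chargeDepth = d 0 + ρ − ρ·maxKink/2`, `chargeDepth_eq_maxKink`,
  which rests on `hKink_hAxis : the attributed axis attains the max-kink`).

THE WLOG (PROVED): `stencilChartLawQ_of_normalForm` — if every tuple has a relabelling in a normal-form class `N`, the chart law (T¹ᶜ) restricted to
`N` implies (T¹ᶜ).  Two normal forms with their covering lemmas: AXIS ZERO FIRST (`exists_relabel_axisZero`: axis `0` has the least pole sum, i.e.
the max kink — the attribution the stations of NODE 110 assume; ÷6) and the FULL normal form (`exists_relabel_normalForm`: additionally the `true`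
pole is the shallower one on every axis; ÷48), packaged as `stencilChartLawQ_of_axisZero` / `stencilChartLawQ_of_fullNormalForm`.
[EQUIV (a symmetry of the statement; no estimate moved, no constant changed) · COUNT-CRITICAL: the census of (T¹ᶜ) runs over one Weyl chamber of
the pole-sum simplex (and one pole order per axis) instead of all 48 · (T¹ᶜ) itself UNDECIDED(test = (D¹)).] -/

noncomputable section

open scoped Classical
open Literature.MathematicalPhysics.StatisticalMechanics Literature.Geometry.DiscreteGeometry
open Summit.AtomisticToContinuum.Crystallization.Theses.PricedLinkCensus
open Summit.AtomisticToContinuum.Crystallization.Theorems.ChargedEnergyGapNegative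

namespace Summit.AtomisticToContinuum.Crystallization.Theorems.ChargedEnergyGapChartDial

/-! ## §111.1 The signed axis permutation of the lattice and the relabelled tuple -/
section Action

/-- The sign of the pole-flip pattern `σ` on axis `a`: `−1` if the poles of axis `a` are swapped, else `+1`. -/
def flipSign (σ : Fin 8) (a : Fin 3) : ℤ := if sgn σ a then -1 else 1

/-- ★ The SIGNED AXIS PERMUTATION of `ℤ³` inducing `relabel g σ`: `e_a ↦ flipSign σ a • e_{axp g a}`, i.e. coordinate `c` of the image of `p` is
`flipSign σ (axpInv g c) · p (axpInv g c)`. -/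
def latMap (g : Fin 6) (σ : Fin 8) (p : Fin 3 → ℤ) : Fin 3 → ℤ := fun c => flipSign σ (axpInv g c) * p (axpInv g c)

/-- ★ The RELABELLED DEPTH TUPLE: pull-back of `dt` along `latMap g σ`. -/
def tupleRelabel (g : Fin 6) (σ : Fin 8) (dt : (Fin 3 → ℤ) → ℝ) : (Fin 3 → ℤ) → ℝ := fun p => dt (latMap g σ p)

/-- [finite check, `decide`] `axp g` after `axpInv g` is the identity. -/
theorem axp_axpInv : ∀ (g : Fin 6) (c : Fin 3), axp g (axpInv g c) = c := by decide

/-- [finite check, `decide`] `axpInv g` after `axp g` is the identity. -/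
theorem axpInv_axp : ∀ (g : Fin 6) (a : Fin 3), axpInv g (axp g a) = a := by decide

/-- [finite check, `decide`] every flip pattern `Fin 3 → Bool` is some `sgn σ`. -/
theorem sgn_surjective : ∀ f : Fin 3 → Bool, ∃ σ : Fin 8, sgn σ = f := by decide

/-- `flipSign σ a` is `±1`: its real square is `1`. [formal bookkeeping] -/
theorem flipSign_sq (σ : Fin 8) (a : Fin 3) : ((flipSign σ a : ℤ) : ℝ) ^ 2 = 1 := by
  unfold flipSign; split_ifs <;> norm_num

/-- `flipSign σ a · poleSign b = poleSign (sgn σ a xor b)`. [formal bookkeeping] -/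
theorem flipSign_mul_poleSign (σ : Fin 8) (a : Fin 3) (b : Bool) : flipSign σ a * poleSign b = poleSign (xor (sgn σ a) b) := by
  unfold flipSign poleSign; cases sgn σ a <;> cases b <;> simp

/-- The signed permutation fixes the hole. -/
theorem latMap_zero (g : Fin 6) (σ : Fin 8) : latMap g σ 0 = 0 := by
  funext c; simp [latMap]

/-- ★ The signed permutation maps vertex `q` of the hole `0` to vertex `relabel g σ q`. -/
theorem latMap_holeVertex (g : Fin 6) (σ : Fin 8) (q : Fin 3 × Bool) : latMap g σ (holeVertex 0 q) = holeVertex 0 (relabel g σ q) := by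
  funext c
  simp only [latMap, holeVertex, relabel, zero_add, Pi.smul_apply, axisZ, smul_eq_mul]
  by_cases hc : axpInv g c = q.1
  · have hc' : c = axp g q.1 := by rw [← hc, axp_axpInv]
    rw [if_pos hc, if_pos hc', mul_one, mul_one, hc, flipSign_mul_poleSign]
  · have hc' : ¬ c = axp g q.1 := fun h => hc (by rw [h, axpInv_axp])
    rw [if_neg hc, if_neg hc', mul_zero, mul_zero, mul_zero]

/-- The signed permutation permutes the stencil of the hole. -/
theorem latMap_mem_stencil (g : Fin 6) (σ : Fin 8) {p : Fin 3 → ℤ} (hp : p ∈ stencil 0) : latMap g σ p ∈ stencil 0 := by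
  rcases (mem_stencil_zero_iff p).1 hp with rfl | ⟨u, rfl⟩
  · rw [latMap_zero]; exact mem_stencil_self 0
  · rw [latMap_holeVertex]; exact mem_stencil_vertex 0 _

/-- The relabelled tuple at the centre. -/
theorem tupleRelabel_zero (g : Fin 6) (σ : Fin 8) (dt : (Fin 3 → ℤ) → ℝ) : tupleRelabel g σ dt 0 = dt 0 := by
  simp [tupleRelabel, latMap_zero]

/-- ★ The relabelled tuple at vertex `q` is `dt` at vertex `relabel g σ q`. -/
theorem tupleRelabel_vertex (g : Fin 6) (σ : Fin 8) (dt : (Fin 3 → ℤ) → ℝ) (q : Fin 3 × Bool) :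
    tupleRelabel g σ dt (holeVertex 0 q) = dt (holeVertex 0 (relabel g σ q)) := by
  simp [tupleRelabel, latMap_holeVertex]

/-- The vertex weights of the relabelled tuple are the relabelled vertex weights. -/
theorem vtxW_tupleRelabel (ϱ : ℝ) (g : Fin 6) (σ : Fin 8) (dt : (Fin 3 → ℤ) → ℝ) :
    vtxW ϱ (tupleRelabel g σ dt) 0 = fun p => vtxW ϱ dt 0 (relabel g σ p) := by
  funext p; simp [vtxW, tupleRelabel_vertex]

end Action

/-! ## §111.2 The four invariances -/
section Invariance

variable (g : Fin 6) (σ : Fin 8)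

/-- (1) POSITIVITY on the stencil is invariant. -/
theorem pos_tupleRelabel {dt : (Fin 3 → ℤ) → ℝ} (h : ∀ p ∈ stencil 0, 0 < dt p) : ∀ p ∈ stencil 0, 0 < tupleRelabel g σ dt p :=
  fun _ hp => h _ (latMap_mem_stencil g σ hp)

/-- The TWISTED DIRECTION: the unit direction `u` of the image point pulled back by the signed permutation (`u'_k = flipSign σ k · u_{axp g k}`). -/
def twistVec (u : E3) : E3 := WithLp.toLp 2 fun k => (flipSign σ k : ℝ) * u (axp g k)

/-- [formal bookkeeping] coordinates of the twisted direction. -/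
theorem twistVec_apply (u : E3) (k : Fin 3) : twistVec g σ u k = (flipSign σ k : ℝ) * u (axp g k) := rfl

/-- The twisted direction of a unit vector is a unit vector. -/
theorem norm_twistVec {u : E3} (hu : ‖u‖ = 1) : ‖twistVec g σ u‖ = 1 := by
  have h2 : ‖twistVec g σ u‖ ^ 2 = 1 := by
    rw [EuclideanSpace.real_norm_sq_eq]
    have e : ∀ k, twistVec g σ u k ^ 2 = (fun c : Fin 3 => u c ^ 2) (axp g k) := fun k => by
      rw [twistVec_apply, mul_pow, flipSign_sq, one_mul]
    rw [Finset.sum_congr rfl fun k _ => e k, ← sum_axpInv g (fun a => (fun c : Fin 3 => u c ^ 2) (axp g a))]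
    simp only [axp_axpInv]
    rw [← EuclideanSpace.real_norm_sq_eq, hu, one_pow]
  have h0 : 0 ≤ ‖twistVec g σ u‖ := norm_nonneg _
  nlinarith [h2, h0]

/-- [formal bookkeeping] the coordinate difference of two image points. -/
theorem latMap_sub_cast (p q : Fin 3 → ℤ) (c : Fin 3) :
    ((latMap g σ q c - latMap g σ p c : ℤ) : ℝ) = (flipSign σ (axpInv g c) : ℝ) * ((q (axpInv g c) - p (axpInv g c) : ℤ) : ℝ) := by
  simp only [latMap]; push_cast; ring

/-- (2) ★★ CHART REALISABILITY is invariant: the rows of `p'` against `q'` for the twisted direction are the rows of the image points. -/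
theorem isChartRealisable_tupleRelabel {ρ : ℝ} {dt : (Fin 3 → ℤ) → ℝ} (h : IsChartRealisable ρ dt) :
    IsChartRealisable ρ (tupleRelabel g σ dt) := by
  intro p' hp'
  obtain ⟨u, hu, hrows⟩ := h (latMap g σ p') (latMap_mem_stencil g σ hp')
  refine ⟨twistVec g σ u, norm_twistVec g σ hu, fun q' hq' => ?_⟩
  have hr := hrows (latMap g σ q') (latMap_mem_stencil g σ hq')
  rw [realisRow_iff_coord] at hr ⊢
  have e1 : ∑ k, ((q' k - p' k : ℤ) : ℝ) * twistVec g σ u k = ∑ c, ((latMap g σ q' c - latMap g σ p' c : ℤ) : ℝ) * u c := by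
    rw [← sum_axpInv g (fun k => ((q' k - p' k : ℤ) : ℝ) * twistVec g σ u k)]
    refine Finset.sum_congr rfl fun c _ => ?_
    rw [twistVec_apply, axp_axpInv, latMap_sub_cast]; ring
  have e2 : ∑ k, ((q' k - p' k : ℤ) : ℝ) ^ 2 = ∑ c, ((latMap g σ q' c - latMap g σ p' c : ℤ) : ℝ) ^ 2 := by
    rw [← sum_axpInv g (fun k => ((q' k - p' k : ℤ) : ℝ) ^ 2)]
    refine Finset.sum_congr rfl fun c _ => ?_
    rw [latMap_sub_cast, mul_pow, flipSign_sq, one_mul]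
  show 2 * dt (latMap g σ p') * (ρ * ∑ k, ((q' k - p' k : ℤ) : ℝ) * twistVec g σ u k) ≤
    ρ ^ 2 * ∑ k, ((q' k - p' k : ℤ) : ℝ) ^ 2 + dt (latMap g σ p') ^ 2 - dt (latMap g σ q') ^ 2
  rw [e1, e2]; exact hr

/-- (3a) the MIN VERTEX DEPTH is invariant. -/
theorem hDepthMin_tupleRelabel (dt : (Fin 3 → ℤ) → ℝ) : hDepthMin (tupleRelabel g σ dt) 0 = hDepthMin dt 0 := by
  unfold hDepthMin
  simp only [tupleRelabel_vertex]
  refine le_antisymm (Finset.le_inf' _ _ fun u _ => ?_) (Finset.le_inf' _ _ fun u _ => ?_)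
  · obtain ⟨u', hu'⟩ := (relabel_bijective g σ).2 u
    exact (Finset.inf'_le _ (Finset.mem_univ u')).trans_eq (by rw [hu'])
  · exact Finset.inf'_le _ (Finset.mem_univ (relabel g σ u))

/-- (3b) the axial KINK of the relabelled tuple on axis `a` is the kink on axis `axp g a`. -/
theorem hKink_tupleRelabel (ρ : ℝ) (dt : (Fin 3 → ℤ) → ℝ) (a : Fin 3) :
    hKink ρ (tupleRelabel g σ dt) 0 a = hKink ρ dt 0 (axp g a) := by
  unfold hKink
  rw [← fc_holeVertex_true (0 : Fin 3 → ℤ) a, ← fc_holeVertex_false (0 : Fin 3 → ℤ) a, ← fc_holeVertex_true (0 : Fin 3 → ℤ) (axp g a),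
    ← fc_holeVertex_false (0 : Fin 3 → ℤ) (axp g a), tupleRelabel_vertex, tupleRelabel_vertex, tupleRelabel_zero]
  simp only [relabel, Bool.xor_true, Bool.xor_false]
  cases sgn σ a <;> simp only [Bool.not_false, Bool.not_true]
  ring

/-- (3c) the MAX-KINK is invariant. -/
theorem hMaxKink_tupleRelabel (ρ : ℝ) (dt : (Fin 3 → ℤ) → ℝ) : hMaxKink ρ (tupleRelabel g σ dt) 0 = hMaxKink ρ dt 0 := by
  unfold hMaxKink
  refine le_antisymm (Finset.sup'_le _ _ fun a _ => ?_) (Finset.sup'_le _ _ fun c _ => ?_)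
  · rw [hKink_tupleRelabel]; exact Finset.le_sup' _ (Finset.mem_univ _)
  · have e : hKink ρ dt 0 c = hKink ρ (tupleRelabel g σ dt) 0 (axpInv g c) := by rw [hKink_tupleRelabel, axp_axpInv]
    rw [e]; exact Finset.le_sup' _ (Finset.mem_univ _)

/-- (3) ★ TUPLE ADMISSIBILITY is invariant. -/
theorem isTupleHole_tupleRelabel (dK ρ : ℝ) (dt : (Fin 3 → ℤ) → ℝ) : IsTupleHole dK ρ (tupleRelabel g σ dt) ↔ IsTupleHole dK ρ dt := by
  unfold IsTupleHole
  rw [hDepthMin_tupleRelabel, hMaxKink_tupleRelabel]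

/-- (4a) ★ the FEET HOLE COST is invariant (one LP per hole, `roofVal_relabel`). -/
theorem feetHoleCost_tupleRelabel (ϱ τ ρ : ℝ) (dt : (Fin 3 → ℤ) → ℝ) :
    feetHoleCost ϱ τ ρ (tupleRelabel g σ dt) 0 = feetHoleCost ϱ τ ρ dt 0 := by
  rw [feetHoleCost_eq_roofVal, feetHoleCost_eq_roofVal, vtxW_tupleRelabel, roofVal_relabel]

-- LANE EDITION (hand-2 g44, gate `dedup.landed`): the node's `hKink_hAxis` restates the landed `fc_hKink_hAxis`
-- (…ChargedEnergyGapFibreChargeC, same docket namespace, identical statement); dropped, the landed lemma is cited below.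

/-- ★ The ATTRIBUTION-FREE FORMULA for the charge depth: `chargeDepth ρ d w = d w + ρ − ρ · maxKink / 2` (`ρ ≠ 0`). -/
theorem chargeDepth_eq_maxKink {ρ : ℝ} (hρ : ρ ≠ 0) (d : (Fin 3 → ℤ) → ℝ) (w : Fin 3 → ℤ) :
    chargeDepth ρ d w = d w + ρ - ρ * hMaxKink ρ d w / 2 := by
  have hk := fc_hKink_hAxis ρ d w
  unfold hKink at hk
  rw [div_eq_iff hρ] at hk
  unfold chargeDepth
  linarith

/-- (4b) ★ the CHARGE DEPTH is invariant (`ρ ≠ 0`). -/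
theorem chargeDepth_tupleRelabel {ρ : ℝ} (hρ : ρ ≠ 0) (dt : (Fin 3 → ℤ) → ℝ) :
    chargeDepth ρ (tupleRelabel g σ dt) 0 = chargeDepth ρ dt 0 := by
  rw [chargeDepth_eq_maxKink hρ, chargeDepth_eq_maxKink hρ, hMaxKink_tupleRelabel, tupleRelabel_zero]

end Invariance

/-! ## §111.3 WLOG: the chart law on a fundamental domain -/
section WLOG

/-- ★★★ **WLOG BY RELABELLING**: if every tuple has a relabelling in the normal-form class `N`, the chart law (T¹ᶜ) restricted to `N` gives (T¹ᶜ). -/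
theorem stencilChartLawQ_of_normalForm {dK unit ϱ τ ρlo ρhi : ℝ} (hρ : 0 < ρlo) (N : ((Fin 3 → ℤ) → ℝ) → Prop)
    (hN : ∀ dt : (Fin 3 → ℤ) → ℝ, ∃ (g : Fin 6) (σ : Fin 8), N (tupleRelabel g σ dt))
    (h : ∀ ρ : ℝ, ρlo ≤ ρ → ρ ≤ ρhi → ∀ dt : (Fin 3 → ℤ) → ℝ, N dt → (∀ p ∈ stencil 0, 0 < dt p) → IsChartRealisable ρ dt →
      IsTupleHole dK ρ dt → feetHoleCost ϱ τ ρ dt 0 ≤ domCapK unit ϱ τ ρ (chargeDepth ρ dt 0)) :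
    StencilChartLawQ dK unit ϱ τ ρlo ρhi := by
  intro ρ h₁ h₂ dt hpos hreal hhole
  obtain ⟨g, σ, hn⟩ := hN dt
  have hρ' : ρ ≠ 0 := (hρ.trans_le h₁).ne'
  have hlaw := h ρ h₁ h₂ _ hn (pos_tupleRelabel g σ hpos) (isChartRealisable_tupleRelabel g σ hreal)
    ((isTupleHole_tupleRelabel g σ dK ρ dt).2 hhole)
  rwa [feetHoleCost_tupleRelabel, chargeDepth_tupleRelabel g σ hρ'] at hlaw

/-- The POLE SUM of the tuple `dt` on axis `a`: `dt(e_a) + dt(−e_a)` (the max-kink axis is the axis of least pole sum). -/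
def poleSum (dt : (Fin 3 → ℤ) → ℝ) (a : Fin 3) : ℝ := dt (holeVertex 0 (a, true)) + dt (holeVertex 0 (a, false))

/-- The pole sum of the relabelled tuple on axis `a` is the pole sum on axis `axp g a`. -/
theorem poleSum_tupleRelabel (g : Fin 6) (σ : Fin 8) (dt : (Fin 3 → ℤ) → ℝ) (a : Fin 3) :
    poleSum (tupleRelabel g σ dt) a = poleSum dt (axp g a) := by
  unfold poleSum
  rw [tupleRelabel_vertex, tupleRelabel_vertex]
  simp only [relabel, Bool.xor_true, Bool.xor_false]
  cases sgn σ a <;> simp only [Bool.not_false, Bool.not_true]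
  ring

/-- The axial kink at the hole `0` in terms of the pole sum: `hKink ρ dt 0 a = (2·dt 0 − poleSum dt a)/ρ`. [formal bookkeeping] -/
theorem hKink_zero_eq_poleSum (ρ : ℝ) (dt : (Fin 3 → ℤ) → ℝ) (a : Fin 3) : hKink ρ dt 0 a = (2 * dt 0 - poleSum dt a) / ρ := by
  unfold hKink poleSum
  rw [← fc_holeVertex_true (0 : Fin 3 → ℤ) a, ← fc_holeVertex_false (0 : Fin 3 → ℤ) a]
  ring

/-- ★ In the axis-zero chamber the max-kink is the axis-`0` kink (`0 < ρ`). -/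
theorem hMaxKink_of_axisZero {ρ : ℝ} (hρ : 0 < ρ) {dt : (Fin 3 → ℤ) → ℝ} (h1 : poleSum dt 0 ≤ poleSum dt 1) (h2 : poleSum dt 0 ≤ poleSum dt 2) :
    hMaxKink ρ dt 0 = hKink ρ dt 0 0 := by
  unfold hMaxKink
  refine le_antisymm (Finset.sup'_le _ _ fun a _ => ?_) (Finset.le_sup' _ (Finset.mem_univ _))
  rw [hKink_zero_eq_poleSum, hKink_zero_eq_poleSum]
  refine div_le_div_of_nonneg_right ?_ hρ.le
  fin_cases a
  · exact le_rfl
  · show 2 * dt 0 - poleSum dt 1 ≤ 2 * dt 0 - poleSum dt 0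
    linarith
  · show 2 * dt 0 - poleSum dt 2 ≤ 2 * dt 0 - poleSum dt 0
    linarith

/-- ★★ In the axis-zero chamber the CHARGE DEPTH IS THE AXIS-0 POLE MEAN PLUS `ρ` — for EVERY tuple of the chamber, whatever the box: a station inside the
chamber needs the axis-`0` cap block only (no geometric vacuity test for axes `1, 2`). -/
theorem chargeDepth_of_axisZero {ρ : ℝ} (hρ : 0 < ρ) {dt : (Fin 3 → ℤ) → ℝ} (h1 : poleSum dt 0 ≤ poleSum dt 1) (h2 : poleSum dt 0 ≤ poleSum dt 2) :
    chargeDepth ρ dt 0 = poleSum dt 0 / 2 + ρ := by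
  rw [chargeDepth_eq_maxKink hρ.ne', hMaxKink_of_axisZero hρ h1 h2, hKink_zero_eq_poleSum]
  field_simp
  ring

/-- ★ AXIS ZERO FIRST (÷6): every tuple has a relabelling (no pole flips) whose axis `0` has the least pole sum. -/
theorem exists_relabel_axisZero (dt : (Fin 3 → ℤ) → ℝ) : ∃ (g : Fin 6) (σ : Fin 8),
    poleSum (tupleRelabel g σ dt) 0 ≤ poleSum (tupleRelabel g σ dt) 1 ∧ poleSum (tupleRelabel g σ dt) 0 ≤ poleSum (tupleRelabel g σ dt) 2 := by
  simp only [poleSum_tupleRelabel]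
  rcases le_total (poleSum dt 0) (poleSum dt 1) with h01 | h10
  · rcases le_total (poleSum dt 0) (poleSum dt 2) with h02 | h20
    · exact ⟨0, 0, by simpa [axp] using h01, by simpa [axp] using h02⟩
    · exact ⟨4, 0, by simpa [axp] using h20, by simpa [axp] using h20.trans h01⟩
  · rcases le_total (poleSum dt 1) (poleSum dt 2) with h12 | h21
    · exact ⟨2, 0, by simpa [axp] using h10, by simpa [axp] using h12⟩
    · exact ⟨4, 0, by simpa [axp] using h21.trans h10, by simpa [axp] using h21⟩

/-- ★ The FULL NORMAL FORM (÷48): axis `0` has the least pole sum AND on every axis the `true` pole is the shallower one. -/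
theorem exists_relabel_normalForm (dt : (Fin 3 → ℤ) → ℝ) : ∃ (g : Fin 6) (σ : Fin 8),
    (poleSum (tupleRelabel g σ dt) 0 ≤ poleSum (tupleRelabel g σ dt) 1 ∧ poleSum (tupleRelabel g σ dt) 0 ≤ poleSum (tupleRelabel g σ dt) 2) ∧
    ∀ a : Fin 3, tupleRelabel g σ dt (holeVertex 0 (a, true)) ≤ tupleRelabel g σ dt (holeVertex 0 (a, false)) := by
  obtain ⟨g, σ₀, hg⟩ := exists_relabel_axisZero dt
  obtain ⟨σ, hσ⟩ := sgn_surjective fun a => decide (dt (holeVertex 0 (axp g a, false)) < dt (holeVertex 0 (axp g a, true)))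
  refine ⟨g, σ, ?_, fun a => ?_⟩
  · simpa only [poleSum_tupleRelabel] using hg
  · rw [tupleRelabel_vertex, tupleRelabel_vertex]
    simp only [relabel, hσ, Bool.xor_true, Bool.xor_false]
    by_cases hlt : dt (holeVertex 0 (axp g a, false)) < dt (holeVertex 0 (axp g a, true))
    · simp only [hlt, decide_true, Bool.not_true]; exact hlt.le
    · simp only [hlt, decide_false, Bool.not_false]; exact not_lt.1 hlt

/-- ★★★ (T¹ᶜ) FROM THE AXIS-ZERO CHAMBER: it suffices to check the chart law for tuples whose axis `0` has the least pole sum. -/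
theorem stencilChartLawQ_of_axisZero {dK unit ϱ τ ρlo ρhi : ℝ} (hρ : 0 < ρlo)
    (h : ∀ ρ : ℝ, ρlo ≤ ρ → ρ ≤ ρhi → ∀ dt : (Fin 3 → ℤ) → ℝ, poleSum dt 0 ≤ poleSum dt 1 → poleSum dt 0 ≤ poleSum dt 2 →
      (∀ p ∈ stencil 0, 0 < dt p) → IsChartRealisable ρ dt → IsTupleHole dK ρ dt →
      feetHoleCost ϱ τ ρ dt 0 ≤ domCapK unit ϱ τ ρ (chargeDepth ρ dt 0)) :
    StencilChartLawQ dK unit ϱ τ ρlo ρhi :=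
  stencilChartLawQ_of_normalForm hρ (fun dt => poleSum dt 0 ≤ poleSum dt 1 ∧ poleSum dt 0 ≤ poleSum dt 2) exists_relabel_axisZero
    fun ρ h₁ h₂ dt hn => h ρ h₁ h₂ dt hn.1 hn.2

/-- ★★★ (T¹ᶜ) FROM THE FULL FUNDAMENTAL DOMAIN (÷48): axis `0` of least pole sum and the `true` pole shallower on every axis. -/
theorem stencilChartLawQ_of_fullNormalForm {dK unit ϱ τ ρlo ρhi : ℝ} (hρ : 0 < ρlo)
    (h : ∀ ρ : ℝ, ρlo ≤ ρ → ρ ≤ ρhi → ∀ dt : (Fin 3 → ℤ) → ℝ, poleSum dt 0 ≤ poleSum dt 1 → poleSum dt 0 ≤ poleSum dt 2 →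
      (∀ a : Fin 3, dt (holeVertex 0 (a, true)) ≤ dt (holeVertex 0 (a, false))) →
      (∀ p ∈ stencil 0, 0 < dt p) → IsChartRealisable ρ dt → IsTupleHole dK ρ dt →
      feetHoleCost ϱ τ ρ dt 0 ≤ domCapK unit ϱ τ ρ (chargeDepth ρ dt 0)) :
    StencilChartLawQ dK unit ϱ τ ρlo ρhi :=
  stencilChartLawQ_of_normalForm hρ
    (fun dt => (poleSum dt 0 ≤ poleSum dt 1 ∧ poleSum dt 0 ≤ poleSum dt 2) ∧ ∀ a : Fin 3, dt (holeVertex 0 (a, true)) ≤ dt (holeVertex 0 (a, false)))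
    exists_relabel_normalForm fun ρ h₁ h₂ dt hn => h ρ h₁ h₂ dt hn.1.1 hn.1.2 hn.2

end WLOG

end Summit.AtomisticToContinuum.Crystallization.Theorems.ChargedEnergyGapChartDial
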